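/-
Copyright (c) 2026 the pub-hodgecm-mathlib formalisation cell (harness21).  Prover seat hodgecm-mathlib-LH4-p02 (g8); (C3e) designated by dealer LH4-plan (g7) WORD #30
(2026-09-02 16:03:26Z); census `F0/P3c/LH4/LH4-p02/g8/c3e/CENSUS-C3e-JZeroHighTrace.v1.md`.
-/
import Literature.NumberTheory.Automorphic.UnitaryThreeBorelCosetCountJZeroHigh
import Literature.NumberTheory.Automorphic.UnitaryThreePHTowerRhoUnramified
import Literature.NumberTheory.LocalFields.UnramifiedQuadraticNormResidueShiftPairsTraceUnit
import HarnessLib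

/-!
# Flicker's Prop. 13, HIGH column (`j = 2m − N > m`), trace frame — STAGE (a): the lift dictionary for `X = κ(aσa)⁻¹ + x + c`

Topic `NumberTheory/Automorphic`; namespace `Literature.NumberTheory.Automorphic.UnitaryGroup`; THEOREMS ONLY (kernel lane).  Twin, over `UnramifiedLocalConjDatum σ ϖ`
(no `|2| = 1`), of ★ `UnitaryThreeBorelCosetCountJZeroHigh` §1 `v_norm_sub_le_iff_exists_lift` in the letters of ★ p851968 (C3b) FILE 1
(`X = κν⁻¹ + w + r`, `ν = aσa`, `w = x + z`, so `X = κ(aσa)⁻¹ + x + c` with the LITERAL integral constant `c = z + r`; `C = ϖ^{2ℓ}γ`).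

THE MATHEMATICS [Flicker1998UnitaryFL, Prop. 13 p. 93, cases (c)∕(e)].  In the norm-residue regime the conjugation condition is `|N(X) − C| ≤ |ϖ^j|` with
`|C| = |ϖ^{2ℓ}|`, `2ℓ < j`, and the count runs over the classes `(ā, x̄)` modulo `𝓂^m` (B-p04's `ρ_m`); when the precision `j` exceeds the level `m` (case (e),
`j ≤ m + ℓ`) the condition is still a condition on the CLASS of `X`: order forcing (★ `shift_dvd_of_norm_congr`: a solution has `ϖ^ℓ ∣ X`) and perturbation
(★ `norm_sub_norm_dvd`: `ϖ^m ∣ X − X′`, `ϖ^ℓ ∣ X′` ⇒ `ϖ^{m+ℓ} ∣ N(X) − N(X′)`) make it lift-independent.  Both suppliers are 2-free; the only change from ★ is the class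
of `X`, now `κ̄·(āσ̄ā)⁻¹ + x̄ + c̄`.  HONEST LABEL: count-neutral; HC_CM is proved only modulo the printed citations until rung 0 closes.

## References
* [Flicker1998UnitaryFL] Y. Z. Flicker, *Elementary proof of the fundamental lemma for a unitary group*, Canad. J. Math. 50 (1998): Prop. 13 pp. 91–93, Prop. 8 p. 84.
-/

set_option autoImplicit false

open scoped MatrixGroups WithZero Valued
open Matrix

namespace Literature.NumberTheory.Automorphic

namespace UnitaryGroup

open Literature.NumberTheory.Automorphic.HermitianLattice (UnramifiedLocalConjDatum)
open Literature.NumberTheory.LocalFields.UnramifiedQuadraticNorm IsLocalRing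

variable {K : Type*} [Field K] [Valued K ℤᵐ⁰] {ϖ : K} (σ : K →+* K) {J : Matrix (Fin 3) (Fin 3) K}

/-! ## §1 The lift dictionary (precision beyond the level) -/

section Lift

variable [IsDiscreteValuationRing 𝒪[K]]

/-- **`|N(X) − ϖ^{2ℓ}γ| ≤ |ϖ^j| ↔ some lift `w` of `X̄` has `ϖ^j ∣ N(w) − ϖ^{2ℓ}γ`** for `X = κ(aσa)⁻¹ + x + c` (`|a| = 1`; `κ, x, c` integral), `2ℓ < j ≤ m + ℓ`,
where on classes modulo `𝓂^m` `X̄ = κ̄·Ring.inverse (ā σ̄ā) + x̄ + c̄` (twin of ★ `v_norm_sub_le_iff_exists_lift`, `e ↦ c`, weight `κ`; reads only `σ` isometric and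
`|ϖ| = exp(−1)`). [cite: Flicker1998UnitaryFL, Prop. 13 p. 93] -/
theorem v_norm_sub_le_iff_exists_lift_trace (hd : UnramifiedLocalConjDatum σ ϖ) (hσO : ∀ y : 𝒪[K], (σ.comp 𝒪[K].subtype) y ∈ 𝒪[K])
    {p : 𝒪[K]} (hp : Irreducible p) (hpϖ : (p : K) = ϖ)
    {j m ℓ : ℕ} (hj : 2 * ℓ < j) (hjm : j ≤ m + ℓ) {a κ x c : K} (ha : Valued.v a = 1) (hκ : Valued.v κ ≤ 1) (hx : Valued.v x ≤ 1)
    (hc : Valued.v c ≤ 1) (γ : 𝒪[K]) :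
    Valued.v ((κ * (a * σ a)⁻¹ + x + c) * σ (κ * (a * σ a)⁻¹ + x + c) - ϖ ^ (2 * ℓ) * γ) ≤ Valued.v (ϖ ^ j) ↔
      ∃ w : 𝒪[K], Ideal.Quotient.mk (𝓂[K] ^ m) w =
          Ideal.Quotient.mk (𝓂[K] ^ m) ⟨κ, hκ⟩ *
              Ring.inverse (Ideal.Quotient.mk (𝓂[K] ^ m) ⟨a, ha.le⟩ *
                Ideal.quotientMap (𝓂[K] ^ m) ((σ.comp 𝒪[K].subtype).codRestrict 𝒪[K] hσO)
                  (maximalIdeal_pow_le_comap_codRestrict σ hd.vϖ hd.vσ hσO m) (Ideal.Quotient.mk (𝓂[K] ^ m) ⟨a, ha.le⟩)) +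
            Ideal.Quotient.mk (𝓂[K] ^ m) ⟨x, hx⟩ + Ideal.Quotient.mk (𝓂[K] ^ m) ⟨c, hc⟩ ∧
        p ^ j ∣ w * ((σ.comp 𝒪[K].subtype).codRestrict 𝒪[K] hσO) w - p ^ (2 * ℓ) * γ := by
  have hσa : Valued.v (σ a) ≤ 1 := by rw [hd.vσ]; exact ha.le
  have hn1 : Valued.v (a * σ a) = 1 := by rw [map_mul, hd.vσ, ha, mul_one]
  have hn0 : a * σ a ≠ 0 := fun h => by rw [h, map_zero] at hn1; exact zero_ne_one hn1
  have hninv : Valued.v (a * σ a)⁻¹ ≤ 1 := by rw [map_inv₀, hn1, inv_one]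
  set σm := Ideal.quotientMap (𝓂[K] ^ m) ((σ.comp 𝒪[K].subtype).codRestrict 𝒪[K] hσO)
    (maximalIdeal_pow_le_comap_codRestrict σ hd.vϖ hd.vσ hσO m) with hσm
  have hσmk : ∀ (y : K) (hy : Valued.v y ≤ 1), σm (Ideal.Quotient.mk (𝓂[K] ^ m) ⟨y, hy⟩) =
      Ideal.Quotient.mk (𝓂[K] ^ m) ⟨σ y, by show Valued.v (σ y) ≤ 1; rw [hd.vσ]; exact hy⟩ := fun y hy => by
    rw [hσm, Ideal.quotientMap_mk]; rfl
  -- the inverse class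
  set nO : 𝒪[K] := ⟨a, ha.le⟩ * ⟨σ a, hσa⟩ with hnO
  set niO : 𝒪[K] := ⟨(a * σ a)⁻¹, hninv⟩ with hniO
  have hmul : Ideal.Quotient.mk (𝓂[K] ^ m) nO * Ideal.Quotient.mk (𝓂[K] ^ m) niO = 1 := by
    rw [← map_mul, ← map_one (Ideal.Quotient.mk (𝓂[K] ^ m))]
    congr 1
    apply Subtype.ext
    show (a * σ a) * (a * σ a)⁻¹ = 1
    exact mul_inv_cancel₀ hn0
  have hunit : IsUnit (Ideal.Quotient.mk (𝓂[K] ^ m) nO) := isUnit_iff_exists_inv.2 ⟨_, hmul⟩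
  have hinv : Ring.inverse (Ideal.Quotient.mk (𝓂[K] ^ m) ⟨a, ha.le⟩ * σm (Ideal.Quotient.mk (𝓂[K] ^ m) ⟨a, ha.le⟩)) =
      Ideal.Quotient.mk (𝓂[K] ^ m) niO := by
    rw [hσmk, ← map_mul, ← hnO, ← hunit.unit_spec, Ring.inverse_unit]
    exact Units.inv_eq_of_mul_eq_one_right (by rw [hunit.unit_spec]; exact hmul)
  -- the integral `X`
  set XO : 𝒪[K] := ⟨κ, hκ⟩ * niO + ⟨x, hx⟩ + ⟨c, hc⟩ with hXO
  have hXcoe : (XO : K) = κ * (a * σ a)⁻¹ + x + c := rfl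
  have hX : Ideal.Quotient.mk (𝓂[K] ^ m) ⟨κ, hκ⟩ *
        Ring.inverse (Ideal.Quotient.mk (𝓂[K] ^ m) ⟨a, ha.le⟩ * σm (Ideal.Quotient.mk (𝓂[K] ^ m) ⟨a, ha.le⟩)) +
      Ideal.Quotient.mk (𝓂[K] ^ m) ⟨x, hx⟩ + Ideal.Quotient.mk (𝓂[K] ^ m) ⟨c, hc⟩ = Ideal.Quotient.mk (𝓂[K] ^ m) XO := by
    rw [hinv, hXO, map_add, map_add, map_mul]
  set σO := (σ.comp 𝒪[K].subtype).codRestrict 𝒪[K] hσO with hσOdef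
  have hσp : σO p = p := Subtype.ext (by show σ (p : K) = p; rw [hpϖ, hd.σϖ])
  have hcoe : ((XO * σO XO - p ^ (2 * ℓ) * γ : 𝒪[K]) : K) =
      (κ * (a * σ a)⁻¹ + x + c) * σ (κ * (a * σ a)⁻¹ + x + c) - ϖ ^ (2 * ℓ) * γ := by
    rw [← hXcoe, ← hpϖ]; rfl
  -- the valuation condition is divisibility for the lift `XO`
  have hval : Valued.v ((κ * (a * σ a)⁻¹ + x + c) * σ (κ * (a * σ a)⁻¹ + x + c) - ϖ ^ (2 * ℓ) * γ) ≤ Valued.v (ϖ ^ j) ↔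
      p ^ j ∣ XO * σO XO - p ^ (2 * ℓ) * γ := by
    rw [← mem_maximalIdeal_pow_iff_pow_dvd hp, mem_maximalIdeal_pow_iff_v_le hd.vϖ, hcoe]
  rw [hval, hX]
  constructor
  · exact fun h => ⟨XO, rfl, h⟩
  · rintro ⟨w, hwX, hdw⟩
    have hℓm : ℓ ≤ m := by omega
    have hℓw : p ^ ℓ ∣ w := shift_dvd_of_norm_congr σO hp hσp hj γ hdw
    have hmw : p ^ m ∣ XO - w := by rw [← mem_maximalIdeal_pow_iff_pow_dvd hp, ← Ideal.Quotient.eq, hwX]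
    have hpert := norm_sub_norm_dvd σO hσp hℓm hℓw hmw
    have e1 : XO * σO XO - p ^ (2 * ℓ) * γ = (XO * σO XO - w * σO w) + (w * σO w - p ^ (2 * ℓ) * γ) := by ring
    rw [e1]
    exact dvd_add (dvd_trans (pow_dvd_pow p hjm) hpert) hdw

/-- **The precision-within-level case `j ≤ m`** (cases (c)): then EVERY lift works — `|N(X) − ϖ^{2ℓ}γ| ≤ |ϖ^j|` iff `ϖ^j ∣ N(w) − ϖ^{2ℓ}γ` for any `w ≡ X (mod 𝓂^m)`
(no order forcing needed). [cite: Flicker1998UnitaryFL, Prop. 13 p. 93] -/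
theorem v_norm_sub_le_iff_of_lift_trace (hd : UnramifiedLocalConjDatum σ ϖ) (hσO : ∀ y : 𝒪[K], (σ.comp 𝒪[K].subtype) y ∈ 𝒪[K])
    {p : 𝒪[K]} (hp : Irreducible p) (hpϖ : (p : K) = ϖ) {j m : ℕ} (hjm : j ≤ m) {X : K} (hXv : Valued.v X ≤ 1) (C : 𝒪[K])
    {w : 𝒪[K]} (hw : Ideal.Quotient.mk (𝓂[K] ^ m) w = Ideal.Quotient.mk (𝓂[K] ^ m) ⟨X, hXv⟩) :
    Valued.v (X * σ X - (C : K)) ≤ Valued.v (ϖ ^ j) ↔ p ^ j ∣ w * ((σ.comp 𝒪[K].subtype).codRestrict 𝒪[K] hσO) w - C := by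
  set σO := (σ.comp 𝒪[K].subtype).codRestrict 𝒪[K] hσO with hσOdef
  have hσp : σO p = p := Subtype.ext (by show σ (p : K) = p; rw [hpϖ, hd.σϖ])
  set XO : 𝒪[K] := ⟨X, hXv⟩ with hXO
  have hcoe : ((XO * σO XO - C : 𝒪[K]) : K) = X * σ X - (C : K) := rfl
  have hval : Valued.v (X * σ X - (C : K)) ≤ Valued.v (ϖ ^ j) ↔ p ^ j ∣ XO * σO XO - C := by
    rw [← mem_maximalIdeal_pow_iff_pow_dvd hp, mem_maximalIdeal_pow_iff_v_le hd.vϖ, hcoe]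
  rw [hval]
  have hmw : p ^ m ∣ XO - w := by rw [← mem_maximalIdeal_pow_iff_pow_dvd hp, ← Ideal.Quotient.eq, hw]
  -- `N(XO) − N(w) = (XO − w)σXO + w σ(XO − w)` is divisible by `p^m`, hence by `p^j`
  have hdiff : p ^ j ∣ XO * σO XO - w * σO w := by
    have e : XO * σO XO - w * σO w = (XO - w) * σO XO + w * σO (XO - w) := by rw [map_sub]; ring
    rw [e]
    refine dvd_trans (pow_dvd_pow p hjm) (dvd_add (dvd_mul_of_dvd_left hmw _) (dvd_mul_of_dvd_right ?_ _))
    obtain ⟨q, hq⟩ := hmw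
    exact ⟨σO q, by rw [hq, map_mul, map_pow, hσp]⟩
  constructor
  · intro h
    have e1 : w * σO w - C = (XO * σO XO - C) - (XO * σO XO - w * σO w) := by ring
    rw [e1]; exact dvd_sub h hdiff
  · intro h
    have e1 : XO * σO XO - C = (XO * σO XO - w * σO w) + (w * σO w - C) := by ring
    rw [e1]; exact dvd_add hdiff h

end Lift

/-! ## §2a The re-indexing of the pair set (pure residue-ring algebra) -/

section Reindex

variable {R : Type*} [CommRing R] [IsLocalRing R]

/-- **Re-indexing the pair set**: `(ā, x̄) ↦ (ā, (x̄ + ȳ₀)·d̄⁻¹)` is a bijection from the pairs with ANTI-FIXED second coordinate solving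
`∃ w ≡ κ̄(āσ̄ā)⁻¹ + x̄ + c̄, p^j ∣ N(w) − p^{2ℓ}γ` onto the pairs with FIXED second coordinate solving `∃ w ≡ (āσ̄ā)⁻¹ + ē + η·ḡ, p^j ∣ N(w) − p^{2ℓ}γ′`, where
`c = κe + y₀`, `g = κ⁻¹d`, `γ′ = γ∕N(κ)` (`d` an anti-fixed unit, `y₀` anti-fixed, `κκ⁻¹ = 1`; witnesses `w ↦ wκ⁻¹`).  This is the whole difference between the trace-frame
pair set and LH7-p02's frame-currency pair set. [cite: Flicker1998UnitaryFL, Prop. 13 p. 93] -/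
theorem natCard_pairs_reindex_frame (σO : R →+* R) (hσ : ∀ a, σO (σO a) = a) (m j ℓ : ℕ) {p κO κi dO eO y₀O γO cO gO γ' : R}
    (hκκi : κO * κi = 1) (hdu : IsUnit dO) (hσd : σO dO = -dO) (hσy₀ : σO y₀O = -y₀O) (hc : cO = κO * eO + y₀O) (hg : gO = κi * dO)
    (hγ' : γ' = γO * (κi * σO κi)) :
    Nat.card {ux : (R ⧸ maximalIdeal R ^ m) × (R ⧸ maximalIdeal R ^ m) // IsUnit ux.1 ∧
        Ideal.quotientMap (maximalIdeal R ^ m) σO (maximalIdeal_pow_le_comap σO hσ m) ux.2 = -ux.2 ∧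
        ∃ w : R, Ideal.Quotient.mk (maximalIdeal R ^ m) w =
            Ideal.Quotient.mk (maximalIdeal R ^ m) κO *
                Ring.inverse (ux.1 * Ideal.quotientMap (maximalIdeal R ^ m) σO (maximalIdeal_pow_le_comap σO hσ m) ux.1) +
              ux.2 + Ideal.Quotient.mk (maximalIdeal R ^ m) cO ∧
          p ^ j ∣ w * σO w - p ^ (2 * ℓ) * γO} =
      Nat.card {uy : (R ⧸ maximalIdeal R ^ m) × (R ⧸ maximalIdeal R ^ m) // IsUnit uy.1 ∧
        Ideal.quotientMap (maximalIdeal R ^ m) σO (maximalIdeal_pow_le_comap σO hσ m) uy.2 = uy.2 ∧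
        ∃ w : R, Ideal.Quotient.mk (maximalIdeal R ^ m) w =
            Ring.inverse (uy.1 * Ideal.quotientMap (maximalIdeal R ^ m) σO (maximalIdeal_pow_le_comap σO hσ m) uy.1) +
              Ideal.Quotient.mk (maximalIdeal R ^ m) eO + uy.2 * Ideal.Quotient.mk (maximalIdeal R ^ m) gO ∧
          p ^ j ∣ w * σO w - p ^ (2 * ℓ) * γ'} := by
  set τ := Ideal.quotientMap (maximalIdeal R ^ m) σO (maximalIdeal_pow_le_comap σO hσ m) with hτ
  set mk := Ideal.Quotient.mk (maximalIdeal R ^ m) with hmk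
  have hτmk : ∀ w : R, τ (mk w) = mk (σO w) := fun w => Ideal.quotientMap_mk
  have hσκκi : σO κO * σO κi = 1 := by rw [← map_mul, hκκi, map_one]
  have hκκiA : mk κO * mk κi = 1 := by rw [← map_mul, hκκi, map_one]
  have hdAu : IsUnit (mk dO) := hdu.map mk
  obtain ⟨D, hD⟩ : ∃ D : (R ⧸ maximalIdeal R ^ m)ˣ, D = hdAu.unit := ⟨_, rfl⟩
  have hDcoe : (D : R ⧸ maximalIdeal R ^ m) = mk dO := by rw [hD]; exact hdAu.unit_spec
  have hτD : τ (D : R ⧸ maximalIdeal R ^ m) = -D := by rw [hDcoe, hτmk, hσd, map_neg]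
  have hτDi : τ (↑D⁻¹ : R ⧸ maximalIdeal R ^ m) = -↑D⁻¹ := map_inv_frame_unit τ D hτD
  have hDD : (↑D⁻¹ : R ⧸ maximalIdeal R ^ m) * D = 1 := by rw [Units.inv_mul]
  have hτy : τ (mk y₀O) = -mk y₀O := by rw [hτmk, hσy₀, map_neg]
  have hgA : mk gO = mk κi * ↑D := by rw [hg, map_mul, hDcoe]
  have hcA : mk cO = mk κO * mk eO + mk y₀O := by rw [hc, map_add, map_mul]
  have hu : γ' * (κO * σO κO) = γO := by
    rw [hγ']
    have : γO * (κi * σO κi) * (κO * σO κO) = γO * (κO * κi) * (σO κO * σO κi) := by ring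
    rw [this, hκκi, hσκκi, mul_one, mul_one]
  let E₂ : (R ⧸ maximalIdeal R ^ m) ≃ (R ⧸ maximalIdeal R ^ m) := (Equiv.addRight (mk y₀O)).trans (Units.mulRight D⁻¹)
  have hE₂ap : ∀ β, E₂ β = (β + mk y₀O) * ↑D⁻¹ := fun β => rfl
  let E := Equiv.prodCongr (Equiv.refl (R ⧸ maximalIdeal R ^ m)) E₂
  refine Nat.card_congr (Equiv.subtypeEquiv E ?_)
  rintro ⟨α, β⟩
  simp only [E, Equiv.prodCongr_apply, Prod.map_apply, Equiv.refl_apply, hE₂ap]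
  refine and_congr_right fun _ => ?_
  refine and_congr ?_ ?_
  · -- anti-fixed `β` ⟺ fixed `(β + ȳ₀)·d̄⁻¹`
    rw [map_mul, map_add, hτDi, hτy]
    constructor
    · intro h; rw [h]; ring
    · intro h
      have h' : (τ β + β) * (↑D⁻¹ : R ⧸ maximalIdeal R ^ m) = 0 := by linear_combination -h
      have h'' : τ β + β = 0 := by simpa using congrArg (· * (D : R ⧸ maximalIdeal R ^ m)) h'
      linear_combination h''
  · -- witnesses: `w ↦ w·κ⁻¹` and back
    constructor
    · rintro ⟨w, hw, hdvd⟩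
      refine ⟨w * κi, ?_, ?_⟩
      · rw [map_mul, hw]
        linear_combination (Ring.inverse (α * τ α) + mk eO) * hκκiA + mk κi * hcA - (β + mk y₀O) * mk κi * hDD
          - (β + mk y₀O) * (↑D⁻¹ : R ⧸ maximalIdeal R ^ m) * hgA
      · have e1 : w * κi * σO (w * κi) - p ^ (2 * ℓ) * γ' = (w * σO w - p ^ (2 * ℓ) * γO) * (κi * σO κi) := by
          rw [map_mul, hγ']; ring
        rw [e1]; exact Dvd.dvd.mul_right hdvd _
    · rintro ⟨w, hw, hdvd⟩
      refine ⟨w * κO, ?_, ?_⟩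
      · rw [map_mul, hw]
        linear_combination (β + mk y₀O) * (mk κO * mk κi) * hDD + (β + mk y₀O) * hκκiA
          + (β + mk y₀O) * (↑D⁻¹ : R ⧸ maximalIdeal R ^ m) * mk κO * hgA - hcA
      · have e1 : w * κO * σO (w * κO) - p ^ (2 * ℓ) * γO = (w * σO w - p ^ (2 * ℓ) * γ') * (κO * σO κO) := by
          rw [map_mul, ← hu]; ring
        rw [e1]; exact Dvd.dvd.mul_right hdvd _

end Reindex

/-! ## §2 The coset count of the HIGH column over the trace-frame criterion -/

section Count

variable [IsDiscreteValuationRing 𝒪[K]] [Finite (ResidueField 𝒪[K])] [IsAdicComplete (maximalIdeal 𝒪[K]) 𝒪[K]]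

/-- **PROP. 13, CASES (c)∕(e) IN THE TRACE FRAME, AS A COSET COUNT over the criterion of ★ p851968 (R-norm).**  Let `τ ∈ U` and suppose that for every `p = p(u, x, w) ∈ P_H`
**`p⁻¹ τ p ∈ H^K_m ↔ |N(κ(uσu)⁻¹ + x + (κe + y₀)) − ϖ^{2ℓ}γ| ≤ |ϖ^j|`** (binder `hce`, values-abstract: `κ` a unit with `|κ + σκ| = 1`, `e` a `σ`-fixed UNIT and `y₀` anti-fixed
— the splitting `z + r = κe + y₀` of FILE 1, `|e| = 1` by ★ p852035 `v_eq_one_of_trace_mul_eq` —, `γ` a `σ`-fixed unit, `1 ≤ ℓ`, `2ℓ < j ≤ m + ℓ`; `d` an anti-fixed unit,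
e.g. `σa₀ − a₀`).  Then, `F` denoting the common fibre size of `ρ_m` on the coset space (`hfib`),
`#{y ∈ P_H ⧸ (P_H ∩ H^K_m) : y⁻¹ τ y ∈ H^K_m} = F · (q^{m−1}(q+1)) · (q^{(m−ℓ)−(j−2ℓ)} · q^{m−ℓ−1}(q+1))` — ★ `natCard_cosets_of_iff_norm_sub_le_high`'s value VERBATIM at
every residue characteristic (FINDING #19 (c1): the HIGH cells carry no `r`-term).  Route = ★'s Steps A–D over C2-A's `_of_unram` heads; Step D re-indexes the anti-fixed
coordinate `x̄ = η·d̄ − ȳ₀` (`η` `σ`-fixed) and rescales by `κ`, landing on LH7-p02's `natCard_pairs_norm_congr_shift_frame_of_isUnit_exists` with frame element `g = κ⁻¹d`,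
shift `e`, target `ϖ^{2ℓ}γ∕N(κ)`. [cite: Flicker1998UnitaryFL, Prop. 13 p. 93; Prop. 8 p. 84] -/
theorem natCard_cosets_of_iff_norm_sub_le_high_trace (hJ : J = (StdForm.antidiagonal 3).over K) (hd : UnramifiedLocalConjDatum σ ϖ) (h2 : (2 : K) ≠ 0)
    (hσO : ∀ y : 𝒪[K], (σ.comp 𝒪[K].subtype) y ∈ 𝒪[K]) {m j ℓ : ℕ} (hm : 1 ≤ m) (hℓ : 1 ≤ ℓ) (hj : 2 * ℓ < j) (hjm : j ≤ m + ℓ)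
    {c um τ : ↥(unitaryGroupOfForm σ J)} (hc : ((c : GL (Fin 3) K) : Matrix (Fin 3) (Fin 3) K) = !![1, 0, 0; 0, -1, 0; 0, 0, 1])
    {κ d e y₀ γ : K} (hκ : Valued.v κ = 1) (htr : Valued.v (κ + σ κ) = 1) (hdv : Valued.v d = 1) (hσd : σ d = -d) (he : Valued.v e = 1) (hσe : σ e = e)
    (hy₀ : Valued.v y₀ ≤ 1) (hσy₀ : σ y₀ = -y₀) (hγ : Valued.v γ = 1) (hσγ : σ γ = γ)
    (hce : ∀ p ∈ flickerPH σ J c, ∀ u x w : K,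
      ((p : GL (Fin 3) K) : Matrix (Fin 3) (Fin 3) K) = !![u, 0, u * x; 0, w, 0; 0, 0, (σ u)⁻¹] →
        (p⁻¹ * τ * p ∈ flickerHK σ J c um ↔
          Valued.v ((κ * (u * σ u)⁻¹ + x + (κ * e + y₀)) * σ (κ * (u * σ u)⁻¹ + x + (κ * e + y₀)) - ϖ ^ (2 * ℓ) * γ) ≤ Valued.v (ϖ ^ j)))
    {q : ℕ} (hq : Nat.card (ResidueField 𝒪[K]) = q ^ 2)
    {a₀ : 𝒪[K]} (ha₀ : IsUnit (((σ.comp 𝒪[K].subtype).codRestrict 𝒪[K] hσO) a₀ - a₀))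
    (hSN : flickerPH σ J c ⊓ flickerHK σ J c um ≤ flickerPH0 σ J c (ϖ ^ m))
    [Finite (↥(flickerPH σ J c) ⧸ (flickerHK σ J c um).subgroupOf (flickerPH σ J c))] {F : ℕ}
    (hfib : ∀ z ∈ Set.range (fun w : ↥(flickerPH σ J c) ⧸ (flickerHK σ J c um).subgroupOf (flickerPH σ J c) =>
        flickerPHRho σ m ((Quotient.out w : ↥(flickerPH σ J c)) : ↥(unitaryGroupOfForm σ J))),
      Nat.card {w : ↥(flickerPH σ J c) ⧸ (flickerHK σ J c um).subgroupOf (flickerPH σ J c) //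
        flickerPHRho σ m ((Quotient.out w : ↥(flickerPH σ J c)) : ↥(unitaryGroupOfForm σ J)) = z} = F) :
    Nat.card {w : ↥(flickerPH σ J c) ⧸ (flickerHK σ J c um).subgroupOf (flickerPH σ J c) //
      ((Quotient.out w : ↥(flickerPH σ J c)) : ↥(unitaryGroupOfForm σ J))⁻¹ * τ * (Quotient.out w : ↥(flickerPH σ J c)) ∈ flickerHK σ J c um} =
      F * ((q ^ (m - 1) * (q + 1)) * (q ^ ((m - ℓ) - (j - 2 * ℓ)) * (q ^ ((m - ℓ) - 1) * (q + 1)))) := by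
  classical
  have hϖ0 : ϖ ≠ 0 := hd.ϖ_ne_zero
  have hunitO : ∀ {y : K} (hy : Valued.v y = 1), IsUnit (⟨y, hy.le⟩ : 𝒪[K]) := fun hy =>
    (Valuation.Integers.isUnit_iff_valuation_eq_one (Valuation.integer.integers _)).2 hy
  -- the restricted involution and the data in `𝒪[K]`
  set σO : 𝒪[K] →+* 𝒪[K] := (σ.comp 𝒪[K].subtype).codRestrict 𝒪[K] hσO with hσOdef
  have hσOσO : ∀ z, σO (σO z) = z := fun z => Subtype.ext (hd.σσ (z : K))
  have hϖle : Valued.v ϖ ≤ 1 := by rw [hd.vϖ, ← WithZero.exp_zero]; exact WithZero.exp_le_exp.2 (by norm_num)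
  set pO : 𝒪[K] := ⟨ϖ, hϖle⟩ with hpO
  have hp : Irreducible pO := (IsDiscreteValuationRing.irreducible_iff_uniformizer pO).2 (maximalIdeal_integer_eq_span hd.vϖ)
  have hσp : σO pO = pO := Subtype.ext (by show σ ϖ = ϖ; exact hd.σϖ)
  set κO : 𝒪[K] := ⟨κ, hκ.le⟩ with hκO
  have hκOu : IsUnit κO := hunitO hκ
  set dO : 𝒪[K] := ⟨d, hdv.le⟩ with hdO
  have hdOu : IsUnit dO := hunitO hdv
  have hσdO : σO dO = -dO := Subtype.ext (by show σ d = -d; exact hσd)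
  set eO : 𝒪[K] := ⟨e, he.le⟩ with heO
  have heOu : IsUnit eO := hunitO he
  have hσeO : σO eO = eO := Subtype.ext (by show σ e = e; exact hσe)
  set y₀O : 𝒪[K] := ⟨y₀, hy₀⟩ with hy₀O
  have hσy₀O : σO y₀O = -y₀O := Subtype.ext (by show σ y₀ = -y₀; exact hσy₀)
  set γO : 𝒪[K] := ⟨γ, hγ.le⟩ with hγO
  have hγOu : IsUnit γO := hunitO hγ
  have hσγO : σO γO = γO := Subtype.ext (by show σ γ = γ; exact hσγ)
  have hcv : Valued.v (κ * e + y₀) ≤ 1 :=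
    le_trans (Valuation.map_add _ _ _) (max_le (by rw [map_mul, hκ, he, mul_one]) hy₀)
  set cO : 𝒪[K] := ⟨κ * e + y₀, hcv⟩ with hcO
  have hcO' : cO = κO * eO + y₀O := Subtype.ext rfl
  -- the frame element `g = κ⁻¹ d` and the rescaled target `γ' = γ ∕ N(κ)`
  set κi : 𝒪[K] := (↑hκOu.unit⁻¹ : 𝒪[K]) with hκi
  have hκκi : κO * κi = 1 := by rw [hκi]; exact hκOu.mul_val_inv
  have hσκκi : σO κO * σO κi = 1 := by rw [← map_mul, hκκi, map_one]
  set gO : 𝒪[K] := κi * dO with hgO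
  have hgOu : IsUnit (σO gO - gO) := by
    -- `σg − g = −d·(κ + σκ)·(κσκ)⁻¹`, a unit since `|κ + σκ| = 1`
    have htrO : IsUnit (κO + σO κO) := by
      rw [(Valuation.Integers.isUnit_iff_valuation_eq_one (Valuation.integer.integers _))]
      show Valued.v (κ + σ κ) = 1
      exact htr
    have e1 : σO gO - gO = -(dO * (κO + σO κO) * (κi * σO κi)) := by
      have h1 : σO gO = σO κi * (-dO) := by rw [hgO, map_mul, hσdO]
      rw [h1, hgO]
      have : dO * (κO + σO κO) * (κi * σO κi) = dO * (κO * κi) * σO κi + dO * (σO κO * σO κi) * κi := by ring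
      rw [this, hκκi, hσκκi]; ring
    rw [e1, IsUnit.neg_iff]
    exact (hdOu.mul htrO).mul ((Units.isUnit hκOu.unit⁻¹).mul ((Units.isUnit hκOu.unit⁻¹).map σO))
  set γ' : 𝒪[K] := γO * (κi * σO κi) with hγ'
  have hγ'u : IsUnit γ' := hγOu.mul ((Units.isUnit hκOu.unit⁻¹).mul ((Units.isUnit hκOu.unit⁻¹).map σO))
  have hσγ' : σO γ' = γ' := by rw [hγ', map_mul, map_mul, hσγO, hσOσO, mul_comm (σO κi) κi]
  -- the predicate counted, in the native currency `(ā, xq)` (xq anti-fixed), and the map `f = ρ_m ∘ out`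
  set P := flickerPH σ J c with hPdef
  set S := (flickerHK σ J c um).subgroupOf (flickerPH σ J c) with hSdef
  set σA := Ideal.quotientMap (maximalIdeal 𝒪[K] ^ m) σO (maximalIdeal_pow_le_comap σO hσOσO m) with hσA
  have hσbar : σA = Ideal.quotientMap (𝓂[K] ^ m) ((σ.comp 𝒪[K].subtype).codRestrict 𝒪[K] hσO)
      (maximalIdeal_pow_le_comap_codRestrict σ hd.vϖ hd.vσ hσO m) := rfl
  have hσAmk : ∀ w : 𝒪[K], σA (Ideal.Quotient.mk _ w) = Ideal.Quotient.mk _ (σO w) := fun w => Ideal.quotientMap_mk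
  have hσAσA : ∀ z, σA (σA z) = z := quotientMap_quotientMap σO hσOσO m
  set f : ↥P ⧸ S → (𝒪[K] ⧸ 𝓂[K] ^ m) × (𝒪[K] ⧸ 𝓂[K] ^ m) := fun w => flickerPHRho σ m ((Quotient.out w : ↥P) : ↥(unitaryGroupOfForm σ J)) with hfdef
  set Q : (𝒪[K] ⧸ 𝓂[K] ^ m) × (𝒪[K] ⧸ 𝓂[K] ^ m) → Prop := fun ux =>
    IsUnit ux.1 ∧ σA ux.2 = -ux.2 ∧
      ∃ w : 𝒪[K], Ideal.Quotient.mk (maximalIdeal 𝒪[K] ^ m) w =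
          Ideal.Quotient.mk (maximalIdeal 𝒪[K] ^ m) κO * Ring.inverse (ux.1 * σA ux.1) + ux.2 + Ideal.Quotient.mk (maximalIdeal 𝒪[K] ^ m) cO ∧
        pO ^ j ∣ w * σO w - pO ^ (2 * ℓ) * γO with hQdef
  -- Step A: «good» ⟺ `Q ∘ f`
  have stepA : ∀ w : ↥P ⧸ S, ((Quotient.out w : ↥P) : ↥(unitaryGroupOfForm σ J))⁻¹ * τ * (Quotient.out w : ↥P) ∈ flickerHK σ J c um ↔ Q (f w) := by
    intro w
    set pp : ↥(unitaryGroupOfForm σ J) := ((Quotient.out w : ↥P) : ↥(unitaryGroupOfForm σ J)) with hpp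
    have hpP : pp ∈ flickerPH σ J c := (Quotient.out w).2
    obtain ⟨u, x, wc, hpm, hvu, hvx, hσx, hvw, hσw⟩ := exists_coe_eq_borel_of_mem_flickerPH' σ hJ hd.σσ hd.vσ h2 hc hpP
    have hu0 : u ≠ 0 := fun h => by rw [h, map_zero] at hvu; exact zero_ne_one hvu
    have hw0 : wc ≠ 0 := fun h => by rw [h, map_zero] at hvw; exact zero_ne_one hvw
    have hva : Valued.v (u * wc⁻¹) = 1 := by rw [map_mul, map_inv₀, hvu, hvw, inv_one, mul_one]
    have hρ : f w = (Ideal.Quotient.mk (𝓂[K] ^ m) ⟨u * wc⁻¹, hva.le⟩, Ideal.Quotient.mk (𝓂[K] ^ m) ⟨x, hvx⟩) := by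
      show flickerPHRho σ m pp = _
      rw [flickerPHRho_of_coe_eq σ m hpm hu0, toQuotPow_of_le m hva.le, toQuotPow_of_le m hvx]
    have hQ1 : σA (f w).2 = -(f w).2 := by rw [hσbar]; exact quotientMap_flickerPHRho_snd_of_unram σ hJ hd h2 hσO hc m hpP
    have hQ2 : IsUnit (f w).1 := isUnit_flickerPHRho_fst_of_unram σ hJ hd h2 hc m hpP
    rw [hce pp hpP u x wc hpm]
    -- rewrite `uσu = N(u w⁻¹)`
    have hσwc : σ wc = wc⁻¹ := eq_inv_of_mul_eq_one_left hσw
    have hN : u * σ u = (u * wc⁻¹) * σ (u * wc⁻¹) := by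
      rw [map_mul, map_inv₀, hσwc, inv_inv]; field_simp
    rw [hN, v_norm_sub_le_iff_exists_lift_trace σ hd hσO hp rfl hj hjm hva hκ.le hvx hcv γO]
    rw [hρ] at hQ1 hQ2
    rw [hQdef, hρ, hσbar]
    exact ⟨fun h => ⟨hQ2, hQ1, h⟩, fun h => h.2.2⟩
  -- Step B: count through `f`
  rw [Nat.card_congr (Equiv.subtypeEquivRight stepA), natCard_subtype_comp_eq_mul f Q F hfib]
  congr 1
  -- Step C: the range condition is implied by `Q` ((H3) surjectivity + (H1) + `S ≤ N₀`, C2-A heads)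
  have stepC : ∀ z, Q z → z ∈ Set.range f := by
    rintro ⟨α, β⟩ ⟨hα, hβ, -⟩
    obtain ⟨a, rfl⟩ := Ideal.Quotient.mk_surjective α
    obtain ⟨bb, rfl⟩ := Ideal.Quotient.mk_surjective β
    have hau : IsUnit a := isUnit_of_isUnit_mk_pow (R := 𝒪[K]) hm hα
    have hav : Valued.v (a : K) = 1 := (Valuation.Integers.isUnit_iff_valuation_eq_one (Valuation.integer.integers _)).1 hau
    rw [hσbar] at hβ
    obtain ⟨pp, hpp, hρ⟩ := exists_mem_flickerPH_flickerPHRho_eq_of_unram σ hJ hd h2 hσO hc m a bb hav hβ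
    refine ⟨QuotientGroup.mk ⟨pp, hpp⟩, ?_⟩
    obtain ⟨s, hs'⟩ := QuotientGroup.mk_out_eq_mul S (⟨pp, hpp⟩ : ↥P)
    show flickerPHRho σ m ((Quotient.out (QuotientGroup.mk (⟨pp, hpp⟩ : ↥P) : ↥P ⧸ S) : ↥P) : ↥(unitaryGroupOfForm σ J)) = _
    rw [hs', Subgroup.coe_mul, ← hρ]
    symm
    rw [flickerPHRho_eq_iff_of_unram σ hJ hd h2 hc m hpp (Subgroup.mul_mem _ hpp (s : ↥P).2), ← mul_assoc, inv_mul_cancel, one_mul]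
    exact hSN ⟨(s : ↥P).2, s.2⟩
  rw [Nat.card_congr (Equiv.subtypeEquivRight fun z => (and_iff_right_of_imp (stepC z) : z ∈ Set.range f ∧ Q z ↔ Q z))]
  -- Step D: re-index to the frame currency (§2a) and apply LH7-p02's pair count
  rw [hQdef, natCard_pairs_reindex_frame σO hσOσO m j ℓ hκκi hdOu hσdO hσy₀O hcO' hgO hγ']
  exact natCard_pairs_norm_congr_shift_frame_of_isUnit_exists σO hσOσO ha₀ hq hgOu hp hσp hm hℓ hj hjm heOu hσeO hγ'u hσγ'

end Count

end UnitaryGroup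

end Literature.NumberTheory.Automorphic
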